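import Mathlib.Analysis.Calculus.FDeriv.Analytic
import Mathlib.Analysis.Calculus.MeanValue
import Mathlib.Analysis.SpecialFunctions.Exponential
import Mathlib.LinearAlgebra.Multilinear.Curry
import Literature.NumberTheory.Automorphic.ArchimedeanEnvelopingAction
import Literature.NumberTheory.Automorphic.AutomorphicFormsKTranslates
import Literature.NumberTheory.Automorphic.ArchimedeanLieDerivSmooth
import HarnessLib

/-!
# Central elements of `U(𝔤)` commute with right translations by exponentials
# (`z ∘ r(exp Y) = r(exp Y) ∘ z` on smooth functions, `𝔤 = 𝔤𝔩(N, A)`)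

Topic `NumberTheory/Automorphic`. For a linear real group `H` with `H.lie = ⊤`, `H.carrier = ⊤`
(the full linear group `GL(N, A)`, `A` finite-dimensional; e.g. `G_∞ = GL_n(K_∞)`), a group `G`
with `ι : H →* G`, an archimedean-smooth `φ : G → ℂ` and a *central* word `p ∈ ℝ⟨𝔤⟩` (image in
the centre `Z(𝔤)` of `U(𝔤)`), the word action commutes with right translation by one-parameter
subgroups:

* `applyFree_lift_Ad_expMem_of_isCentralWord` (**proved**): `(Ad(exp Y) · p) φ = p φ`, where
  `Ad(h) · p` substitutes `Ad(h) X = h X h⁻¹` for every letter `X` of `p`;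
* `applyFree_archTranslate_expMem_of_isCentralWord` (**proved**):
  `p (r(exp Y) φ) = r(exp Y) (p φ)`;
* `applyFree_rightTranslation_of_mem_range_expGL` (**proved**, the `GL_n` datum
  `AutomorphyDatum.gl n K hcpt`): `p (r(x) φ) = r(x) (p φ)` for `x = exp Y ∈ GL_n(K_∞)`.

This is the infinitesimal form of "`Z(𝔤)` consists of bi-invariant differential operators on the
identity component" (Borel–Jacquet 1979, §1.6 and 4.3 (ii); Borel 1997, 2.1–2.2: `Z(𝔤)` is the
algebra of left- *and* right-invariant differential operators; `Ad(g) z = z` for `g` in the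
identity component). Proof (no structure theory of `Z(𝔤)` is used): for
`u(t) := ((Ad(exp tY) · p) φ)(g)` write `p = ∑_w c_w X₁⋯Xₘ` in the word basis; each summand is
`Λ_w(M_w(t))` for the multilinear map `Λ_w(Z₁,…,Zₘ) = (Z₁ ⋯ Zₘ φ)(g)` (multilinear on smooth `φ`,
`lieDerivRep`) and the smooth curve `M_w(t)ᵢ = Ad(exp tY) Xᵢ` with `Ṁᵢ = [Y, Mᵢ]`; so
`u'(t) = ∑_w c_w ∑ᵢ (M₁ ⋯ [Y, Mᵢ] ⋯ Mₘ φ)(g) = (q_t φ)(g)` where the word `q_t` maps to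
`[Y, Ad(exp tY) p] = 0` in `U(𝔤)` (`∑ᵢ a₁⋯[y,aᵢ]⋯aₘ = [y, a₁⋯aₘ]` in any ring; `Ad(exp tY) p` is
central, `isCentralWord_lift_Ad`), hence `q_t φ = 0` (`applyFree_congr_of_top`), `u` is constant
and `u(1) = u(0)`.

Everything here is proved: theorems, plus the auxiliary packaging `RealMatrixGroup.lieOfTop`
(a matrix as an element of `𝔤 = ⊤`), `iterLieDerivMultilinear` / `iterLieDerivCML`
(`Z ↦ (Z₁ ⋯ Zₘ φ)(g)` as a (continuous) multilinear map) and the word `wordFn Z`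
(definitions with unfolding lemmas).

## References

* A. Borel, H. Jacquet, *Automorphic forms and automorphic representations*, Proc. Sympos. Pure
  Math. 33 (Corvallis 1979), part 1, §1.5–1.6, 4.3.
* A. Borel, *Automorphic forms on SL₂(ℝ)*, Cambridge Tracts in Math. 130 (1997), 2.1–2.2, 2.16.
* A. W. Knapp, *Lie Groups Beyond an Introduction* (2002), I.§10, Prop. 1.89–1.91 (`Ad ∘ exp`).
-/

-- Mathlib idiom (Mathlib/Algebra/Lie/OfAssociative.lean); needed to mention Lie subalgebras of matrix algebras
attribute [local instance 100] LieRing.ofAssociativeRing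

open scoped MatrixGroups Matrix ContDiff

noncomputable section

namespace Literature.NumberTheory.Automorphic

/-! ### 0. A ring identity and continuity of multilinear maps on finite-dimensional spaces -/

section Algebra

/-- **Derivation identity for the inner derivation `[y, ·]` along an ordered product**: in any
ring, `∑ᵢ a₁ ⋯ (y aᵢ - aᵢ y) ⋯ aₘ = y (a₁ ⋯ aₘ) - (a₁ ⋯ aₘ) y`. [folklore] -/
theorem sum_prod_ofFn_update_commutator {R : Type*} [Ring R] :
    ∀ (m : ℕ) (a : Fin m → R) (y : R),
      ∑ i, (List.ofFn (Function.update a i (y * a i - a i * y))).prod =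
        y * (List.ofFn a).prod - (List.ofFn a).prod * y
  | 0, a, y => by simp
  | m + 1, a, y => by
    rw [Fin.sum_univ_succ]
    have h0 : List.ofFn (Function.update a 0 (y * a 0 - a 0 * y)) =
        (y * a 0 - a 0 * y) :: List.ofFn (fun i : Fin m => a i.succ) := by
      rw [List.ofFn_succ, Function.update_self]
      simp only [ne_eq, Fin.succ_ne_zero, not_false_eq_true, Function.update_of_ne]
    have hs : ∀ i : Fin m, List.ofFn (Function.update a i.succ (y * a i.succ - a i.succ * y)) =
        a 0 :: List.ofFn (Function.update (fun j : Fin m => a j.succ) i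
          (y * a i.succ - a i.succ * y)) := fun i => by
      rw [List.ofFn_succ, Function.update_of_ne (Fin.succ_ne_zero i).symm]
      exact congrArg (List.cons (a 0)) (congrArg List.ofFn
        (Function.update_comp_eq_of_injective a (Fin.succ_injective m) i _))
    simp_rw [h0, hs, List.prod_cons, ← Finset.mul_sum]
    rw [sum_prod_ofFn_update_commutator m (fun j : Fin m => a j.succ) y, List.ofFn_succ,
      List.prod_cons]
    noncomm_ring

/-- A multilinear map on finitely many copies of a finite-dimensional real normed space with
values in a topological vector space is continuous (expand in a basis: `f Z = ∑_r (∏ᵢ cᵢ) f(b_r)`).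
[folklore] -/
theorem MultilinearMap.continuous_of_finiteDimensional_fin {V : Type*} [NormedAddCommGroup V]
    [NormedSpace ℝ V] [FiniteDimensional ℝ V] {F : Type*} [AddCommGroup F] [Module ℝ F]
    [TopologicalSpace F] [IsTopologicalAddGroup F] [ContinuousSMul ℝ F] {m : ℕ}
    (f : MultilinearMap ℝ (fun _ : Fin m => V) F) : Continuous f := by
  classical
  let b := Module.finBasis ℝ V
  have key : ∀ Z : Fin m → V,
      f Z = ∑ r : Fin m → Fin (Module.finrank ℝ V),
        (∏ i, b.repr (Z i) (r i)) • f (fun i => b (r i)) := by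
    intro Z
    have hZ : Z = fun i => ∑ j, (b.repr (Z i) j) • b j := by
      funext i
      exact (b.sum_repr (Z i)).symm
    conv_lhs => rw [hZ]
    rw [MultilinearMap.map_sum]
    refine Finset.sum_congr rfl fun r _ => ?_
    rw [MultilinearMap.map_smul_univ]
  have hrepr : ∀ j, Continuous fun v : V => b.repr v j := fun j =>
    (b.coord j).continuous_of_finiteDimensional
  have hcont : Continuous fun Z : Fin m → V => ∑ r : Fin m → Fin (Module.finrank ℝ V),
      (∏ i, b.repr (Z i) (r i)) • f (fun i => b (r i)) := by
    refine continuous_finsetSum _ fun r _ => ?_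
    refine Continuous.smul ?_ continuous_const
    exact continuous_finsetProd _ fun i _ => (hrepr (r i)).comp (continuous_apply i)
  exact hcont.congr fun Z => (key Z).symm

end Algebra

/-! ### 1. The multilinear map `Z ↦ (Z₁ ⋯ Zₘ φ)` on smooth `φ` -/

section Multilinear

variable {A : Type*} [NormedCommRing A] [NormedAlgebra ℝ A] [NormedAlgebra ℚ A] [CompleteSpace A]
  [StarRing A] {N : Type*} [Fintype N] [DecidableEq N] {H : RealMatrixGroup A N}
  {G : Type*} [Group G] (ι : H.carrier →* G)

/-- A matrix as an element of `𝔤`, when `𝔤 = 𝔤𝔩(N, A)` (`H.lie = ⊤`). [folklore] -/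
def RealMatrixGroup.lieOfTop (hH : H.lie = ⊤) (M : Matrix N N A) : H.lie :=
  ⟨M, by rw [hH]; exact LieSubalgebra.mem_top M⟩

/-- `lieOfTop hH M = M` as matrices. [folklore] -/
@[simp]
theorem RealMatrixGroup.coe_lieOfTop (hH : H.lie = ⊤) (M : Matrix N N A) :
    (RealMatrixGroup.lieOfTop hH M : Matrix N N A) = M := rfl

/-- `lieOfTop hH X = X` for `X ∈ 𝔤`. [folklore] -/
@[simp]
theorem RealMatrixGroup.lieOfTop_coe (hH : H.lie = ⊤) (X : H.lie) :
    RealMatrixGroup.lieOfTop hH (X : Matrix N N A) = X := Subtype.ext rfl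

variable [FiniteDimensional ℝ A]

/-- One uncurrying step: `X ↦ (Z ↦ X (Ψ Z))`, real-linear in `X ∈ 𝔤` (the Lie algebra action
`lieDerivRep` on smooth functions is real-linear in `X`). Borel–Jacquet 1979, §1.5.
[cite: BorelJacquet1979, §1.5] -/
def lieDerivUncurryStep (hH : H.lie = ⊤) (hc : H.carrier = ⊤) {m : ℕ}
    (Ψ : MultilinearMap ℝ (fun _ : Fin m => H.lie) (archSmooth ι)) :
    H.lie →ₗ[ℝ] MultilinearMap ℝ (fun _ : Fin m => H.lie) (archSmooth ι) where
  toFun X := ((lieDerivRep ι hH hc X).restrictScalars ℝ).compMultilinearMap Ψ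
  map_add' X Y := by
    ext Z
    simp
  map_smul' a X := by
    ext Z
    simp

/-- The iterated Lie derivative `Z ↦ Z₁ (Z₂ (⋯ (Zₘ φ)))` of a smooth `φ` as a real multilinear
map into the space of smooth functions (`𝔤 = 𝔤𝔩(N, A)`, `A` finite-dimensional), built by
left-uncurrying the Lie algebra action `lieDerivRep` on `archSmooth`. Borel–Jacquet 1979, §1.5.
[cite: BorelJacquet1979, §1.5] -/
def iterLieDerivMultilinear (hH : H.lie = ⊤) (hc : H.carrier = ⊤) (φ : archSmooth ι) :
    (m : ℕ) → MultilinearMap ℝ (fun _ : Fin m => H.lie) (archSmooth ι)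
  | 0 => MultilinearMap.constOfIsEmpty ℝ _ φ
  | m + 1 => (lieDerivUncurryStep ι hH hc (iterLieDerivMultilinear hH hc φ m)).uncurryLeft

variable {ι}

/-- Unfolding: `iterLieDerivMultilinear … φ m Z = Z₁ (⋯ (Zₘ φ))` as functions.
Borel–Jacquet 1979, §1.5. [cite: BorelJacquet1979, §1.5] -/
theorem coe_iterLieDerivMultilinear (hH : H.lie = ⊤) (hc : H.carrier = ⊤) (φ : archSmooth ι) :
    ∀ (m : ℕ) (Z : Fin m → H.lie),
      ((iterLieDerivMultilinear ι hH hc φ m Z : archSmooth ι) : G → ℂ) =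
        iterLieDeriv ι (List.ofFn Z) φ
  | 0, Z => by simp [iterLieDerivMultilinear]
  | m + 1, Z => by
    rw [iterLieDerivMultilinear, LinearMap.uncurryLeft_apply, List.ofFn_succ, iterLieDeriv_cons]
    change lieDeriv ι (Z 0) (iterLieDerivMultilinear ι hH hc φ m (Fin.tail Z) : archSmooth ι) = _
    rw [coe_iterLieDerivMultilinear hH hc φ m (Fin.tail Z)]
    rfl

/-- Iterated Lie derivatives of a smooth function are smooth (`𝔤 = 𝔤𝔩(N, A)`). [folklore] -/
theorem isArchSmooth_iterLieDeriv (hH : H.lie = ⊤) {φ : G → ℂ} (hφ : IsArchSmooth ι φ) :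
    ∀ l : List H.lie, IsArchSmooth ι (iterLieDeriv ι l φ)
  | [] => hφ
  | X :: l => by
    rw [iterLieDeriv_cons]
    exact isArchSmooth_lieDeriv_of_lie_eq_top ι hH X (isArchSmooth_iterLieDeriv hH hφ l)

/-- The scalar multilinear map `Λ(M) = (M₁ ⋯ Mₘ φ)(g)` on `m`-tuples of matrices
(`𝔤 = 𝔤𝔩(N, A)`), evaluation at `g` of `iterLieDerivMultilinear` after `lieOfTop`.
Borel–Jacquet 1979, §1.5. [cite: BorelJacquet1979, §1.5] -/
def iterLieDerivMatrixML (hH : H.lie = ⊤) (hc : H.carrier = ⊤) (φ : archSmooth ι) (g : G)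
    (m : ℕ) : MultilinearMap ℝ (fun _ : Fin m => Matrix N N A) ℂ where
  toFun M := ((iterLieDerivMultilinear ι hH hc φ m (fun i => RealMatrixGroup.lieOfTop hH (M i)) :
    archSmooth ι) : G → ℂ) g
  map_update_add' M i x y := by
    have h := congrArg (fun ψ : archSmooth ι => (ψ : G → ℂ) g)
      ((iterLieDerivMultilinear ι hH hc φ m).map_update_add
        (fun j => RealMatrixGroup.lieOfTop hH (M j)) i (RealMatrixGroup.lieOfTop hH x)
        (RealMatrixGroup.lieOfTop hH y))
    simp only [Submodule.coe_add, Pi.add_apply] at h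
    have e : ∀ v : Matrix N N A, (fun j => RealMatrixGroup.lieOfTop hH (Function.update M i v j)) =
        Function.update (fun j => RealMatrixGroup.lieOfTop hH (M j)) i
          (RealMatrixGroup.lieOfTop hH v) := fun v =>
      (Function.comp_update (RealMatrixGroup.lieOfTop hH) M i v :)
    have exy : RealMatrixGroup.lieOfTop hH (x + y) =
        RealMatrixGroup.lieOfTop hH x + RealMatrixGroup.lieOfTop hH y := Subtype.ext rfl
    beta_reduce
    rw [e, e, e, exy]
    exact h
  map_update_smul' M i a x := by
    have h := congrArg (fun ψ : archSmooth ι => (ψ : G → ℂ) g)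
      ((iterLieDerivMultilinear ι hH hc φ m).map_update_smul
        (fun j => RealMatrixGroup.lieOfTop hH (M j)) i a (RealMatrixGroup.lieOfTop hH x))
    simp only [Submodule.coe_smul_of_tower, Pi.smul_apply] at h
    have e : ∀ v : Matrix N N A, (fun j => RealMatrixGroup.lieOfTop hH (Function.update M i v j)) =
        Function.update (fun j => RealMatrixGroup.lieOfTop hH (M j)) i
          (RealMatrixGroup.lieOfTop hH v) := fun v =>
      (Function.comp_update (RealMatrixGroup.lieOfTop hH) M i v :)
    have eax : RealMatrixGroup.lieOfTop hH (a • x) = a • RealMatrixGroup.lieOfTop hH x :=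
      Subtype.ext rfl
    beta_reduce
    rw [e, e, eax]
    exact h

/-- Unfolding: `iterLieDerivMatrixML … φ g m M = (M₁ ⋯ Mₘ φ)(g)`. Borel–Jacquet 1979, §1.5.
[cite: BorelJacquet1979, §1.5] -/
theorem iterLieDerivMatrixML_apply (hH : H.lie = ⊤) (hc : H.carrier = ⊤) (φ : archSmooth ι) (g : G)
    (m : ℕ) (M : Fin m → Matrix N N A) :
    iterLieDerivMatrixML hH hc φ g m M =
      iterLieDeriv ι (List.ofFn fun i => RealMatrixGroup.lieOfTop hH (M i)) φ g := by
  change ((iterLieDerivMultilinear ι hH hc φ m (fun i => RealMatrixGroup.lieOfTop hH (M i)) :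
    archSmooth ι) : G → ℂ) g = _
  rw [coe_iterLieDerivMultilinear]

-- the scoped `L∞`-operator normed structure on matrices (only reducibly defeq to the Pi one)
set_option backward.isDefEq.respectTransparency false in
open scoped Matrix.Norms.Operator in
/-- The same as a **continuous** multilinear map on the normed space `M_N(A)^m` (continuity:
finite-dimensional source). Borel–Jacquet 1979, §1.5. [cite: BorelJacquet1979, §1.5] -/
def iterLieDerivCML (hH : H.lie = ⊤) (hc : H.carrier = ⊤) (φ : archSmooth ι) (g : G) (m : ℕ) :
    ContinuousMultilinearMap ℝ (fun _ : Fin m => Matrix N N A) ℂ where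
  toMultilinearMap := iterLieDerivMatrixML hH hc φ g m
  cont := MultilinearMap.continuous_of_finiteDimensional_fin (iterLieDerivMatrixML hH hc φ g m)

set_option backward.isDefEq.respectTransparency false in
open scoped Matrix.Norms.Operator in
/-- Unfolding: `iterLieDerivCML … φ g m M = (M₁ ⋯ Mₘ φ)(g)`. Borel–Jacquet 1979, §1.5.
[cite: BorelJacquet1979, §1.5] -/
theorem iterLieDerivCML_apply (hH : H.lie = ⊤) (hc : H.carrier = ⊤) (φ : archSmooth ι) (g : G)
    (m : ℕ) (M : Fin m → Matrix N N A) :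
    iterLieDerivCML hH hc φ g m M =
      iterLieDeriv ι (List.ofFn fun i => RealMatrixGroup.lieOfTop hH (M i)) φ g :=
  iterLieDerivMatrixML_apply hH hc φ g m M

end Multilinear

/-! ### 2. Words attached to tuples and the commutator word -/

section Words

variable {A : Type*} [NormedCommRing A] [NormedAlgebra ℝ A] [NormedAlgebra ℚ A] [CompleteSpace A]
  [StarRing A] {N : Type*} [Fintype N] [DecidableEq N] {H : RealMatrixGroup A N}
  {G : Type*} [Group G] (ι : H.carrier →* G)

variable (H) in
/-- The word basis vector `Z₁ ⋯ Zₘ ∈ ℝ⟨𝔤⟩` of a tuple `Z : Fin m → 𝔤`. Dixmier 2.1.1. [folklore] -/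
def wordFn {m : ℕ} (Z : Fin m → H.lie) : FreeAlgebra ℝ H.lie :=
  FreeAlgebra.basisFreeMonoid ℝ H.lie (FreeMonoid.ofList (List.ofFn Z))

/-- `wordFn Z` acts by the iterated Lie derivative along `Z`. Borel–Jacquet 1979, §1.5.
[cite: BorelJacquet1979, §1.5] -/
theorem applyFree_wordFn {m : ℕ} (Z : Fin m → H.lie) (φ : G → ℂ) :
    applyFree ι (wordFn H Z) φ = iterLieDeriv ι (List.ofFn Z) φ := by
  rw [wordFn, applyFree_basisFreeMonoid, FreeMonoid.toList_ofList]

/-- The image of `wordFn Z` in `U(𝔤)` is the ordered product `ι Z₁ ⋯ ι Zₘ`. Dixmier 2.1.1.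
[folklore] -/
theorem freeToEnveloping_wordFn {m : ℕ} (Z : Fin m → H.lie) :
    freeToEnveloping H (wordFn H Z) =
      (List.ofFn fun i => UniversalEnvelopingAlgebra.ι ℝ (Z i)).prod := by
  rw [wordFn, basisFreeMonoid_eq_lift, FreeMonoid.lift_apply, FreeMonoid.toList_ofList,
    map_list_prod, List.map_map, List.map_ofFn]
  congr 1
  refine congrArg List.ofFn (funext fun i => ?_)
  simp [freeToEnveloping_ι]

/-- `applyFree` of a finite sum of polynomials. [folklore] -/
theorem applyFree_finset_sum {J : Type*} (s : Finset J) (q : J → FreeAlgebra ℝ H.lie)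
    (φ : G → ℂ) : applyFree ι (∑ j ∈ s, q j) φ = ∑ j ∈ s, applyFree ι (q j) φ := by
  classical
  induction s using Finset.induction_on with
  | empty =>
    simp only [Finset.sum_empty]
    have h := applyFree_smul_left ι (0 : ℝ) (0 : FreeAlgebra ℝ H.lie) φ
    simpa using h
  | insert a s ha ih => rw [Finset.sum_insert ha, Finset.sum_insert ha, applyFree_add, ih]

/-- `applyFree 0 φ = 0`. [folklore] -/
@[simp]
theorem applyFree_zero_left (φ : G → ℂ) : applyFree ι (0 : FreeAlgebra ℝ H.lie) φ = 0 := by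
  have h := applyFree_smul_left ι (0 : ℝ) (0 : FreeAlgebra ℝ H.lie) φ
  simpa using h

/-- **The commutator word**: `∑ᵢ Z₁ ⋯ [Y, Zᵢ] ⋯ Zₘ` maps to `[ι Y, ι Z₁ ⋯ ι Zₘ]` in `U(𝔤)`
(`ι` is a Lie algebra morphism and `[y, ·]` is a derivation of the associative product).
Dixmier 2.1.1; Borel 1997, 2.16. [folklore] -/
theorem freeToEnveloping_sum_wordFn_update_bracket {m : ℕ} (Y : H.lie) (Z : Fin m → H.lie) :
    freeToEnveloping H (∑ i, wordFn H (Function.update Z i ⁅Y, Z i⁆)) =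
      UniversalEnvelopingAlgebra.ι ℝ Y * freeToEnveloping H (wordFn H Z) -
        freeToEnveloping H (wordFn H Z) * UniversalEnvelopingAlgebra.ι ℝ Y := by
  rw [map_sum]
  simp_rw [freeToEnveloping_wordFn]
  have hupd : ∀ i, (fun j => UniversalEnvelopingAlgebra.ι ℝ (Function.update Z i ⁅Y, Z i⁆ j)) =
      Function.update (fun j => UniversalEnvelopingAlgebra.ι ℝ (Z j)) i
        (UniversalEnvelopingAlgebra.ι ℝ Y * UniversalEnvelopingAlgebra.ι ℝ (Z i) -
          UniversalEnvelopingAlgebra.ι ℝ (Z i) * UniversalEnvelopingAlgebra.ι ℝ Y) := by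
    intro i
    have h := Function.comp_update (UniversalEnvelopingAlgebra.ι ℝ) Z i ⁅Y, Z i⁆
    rw [LieHom.map_lie, Ring.lie_def] at h
    exact h
  simp_rw [hupd]
  exact sum_prod_ofFn_update_commutator m _ _

end Words

/-! ### 3. The curve `t ↦ Ad(exp tY) X` -/

section AdCurve

variable {A : Type*} [NormedCommRing A] [NormedAlgebra ℝ A] [NormedAlgebra ℚ A] [CompleteSpace A]
  [StarRing A] {N : Type*} [Fintype N] [DecidableEq N] {H : RealMatrixGroup A N}

/-- Coercion of scalar multiples in `𝔤`. [folklore] -/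
theorem RealMatrixGroup.coe_lie_smul (r : ℝ) (Y : H.lie) :
    ((r • Y : H.lie) : Matrix N N A) = r • (Y : Matrix N N A) := rfl

/-- `exp(0) = 1` in `H`. [folklore] -/
theorem RealMatrixGroup.expMem_zero : H.expMem 0 = 1 :=
  Subtype.ext (Units.ext (by simp))

/-- `exp(-Y) = exp(Y)⁻¹` in `H` (`expGL_neg`). Knapp 2002, I.§10. [folklore] -/
theorem RealMatrixGroup.expMem_neg (Y : H.lie) : H.expMem (-Y) = (H.expMem Y)⁻¹ := by
  refine Subtype.ext ?_
  change expGL (-(Y : Matrix N N A)) = (expGL (Y : Matrix N N A))⁻¹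
  exact expGL_neg _

/-- The matrix of `Ad(exp sY) X` is `e^{sY} X e^{-sY}`. Knapp 2002, I.§10, (1.83). [folklore] -/
theorem RealMatrixGroup.coe_Ad_expMem_smul (Y X : H.lie) (s : ℝ) :
    ((H.Ad (H.expMem (s • Y)) X : H.lie) : Matrix N N A) =
      NormedSpace.exp (s • (Y : Matrix N N A)) * (X : Matrix N N A) *
        NormedSpace.exp (s • (-(Y : Matrix N N A))) := by
  rw [RealMatrixGroup.Ad_apply_coe]
  have h1 : (((H.expMem (s • Y) : H.carrier) : GL N A) : Matrix N N A) =
      NormedSpace.exp (s • (Y : Matrix N N A)) := by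
    rw [RealMatrixGroup.coe_expMem, coe_expGL, RealMatrixGroup.coe_lie_smul]
  have h2 : ((((H.expMem (s • Y) : H.carrier) : GL N A)⁻¹ : GL N A) : Matrix N N A) =
      NormedSpace.exp (s • (-(Y : Matrix N N A))) := by
    rw [RealMatrixGroup.coe_expMem, ← expGL_neg, coe_expGL, RealMatrixGroup.coe_lie_smul, smul_neg]
  rw [h1, h2]

-- the scoped `L∞`-operator normed structure on matrices (only reducibly defeq to the Pi one)
set_option backward.isDefEq.respectTransparency false in
open scoped Matrix.Norms.Operator in
/-- **The curve `t ↦ Ad(exp tY) X` is differentiable with derivative `[Y, Ad(exp tY) X]`**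
(`d/dt (e^{tY} X e^{-tY}) = Y e^{tY} X e^{-tY} - e^{tY} X e^{-tY} Y`), as a matrix-valued curve.
Knapp 2002, I.§10, Prop. 1.91 (`d/dt Ad(exp tY) = ad Y ∘ Ad(exp tY)`). [folklore] -/
theorem RealMatrixGroup.hasDerivAt_coe_Ad_expMem (Y X : H.lie) (t : ℝ) :
    HasDerivAt (fun s : ℝ => ((H.Ad (H.expMem (s • Y)) X : H.lie) : Matrix N N A))
      ((⁅Y, H.Ad (H.expMem (t • Y)) X⁆ : H.lie) : Matrix N N A) t := by
  set c : ℝ → Matrix N N A := fun s =>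
    NormedSpace.exp (s • (Y : Matrix N N A)) * (X : Matrix N N A) *
      NormedSpace.exp (s • (-(Y : Matrix N N A))) with hc
  have hcoe : (fun s : ℝ => ((H.Ad (H.expMem (s • Y)) X : H.lie) : Matrix N N A)) = c :=
    funext fun s => RealMatrixGroup.coe_Ad_expMem_smul Y X s
  have hcd : HasDerivAt c ((Y : Matrix N N A) * c t - c t * (Y : Matrix N N A)) t := by
    have h1 : HasDerivAt (fun s : ℝ => NormedSpace.exp (s • (Y : Matrix N N A)))
        ((Y : Matrix N N A) * NormedSpace.exp (t • (Y : Matrix N N A))) t :=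
      hasDerivAt_exp_smul_const' (𝕂 := ℝ) (Y : Matrix N N A) t
    have h2 : HasDerivAt (fun s : ℝ => NormedSpace.exp (s • (-(Y : Matrix N N A))))
        (NormedSpace.exp (t • (-(Y : Matrix N N A))) * (-(Y : Matrix N N A))) t :=
      hasDerivAt_exp_smul_const (𝕂 := ℝ) (-(Y : Matrix N N A)) t
    have h := (h1.mul_const (X : Matrix N N A)).mul h2
    convert h using 1
    all_goals first | rfl | (simp only [hc]; noncomm_ring)
  have hval : ((⁅Y, H.Ad (H.expMem (t • Y)) X⁆ : H.lie) : Matrix N N A) =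
      (Y : Matrix N N A) * c t - c t * (Y : Matrix N N A) := by
    rw [LieSubalgebra.coe_bracket, Ring.lie_def, RealMatrixGroup.coe_Ad_expMem_smul]
  rw [hcoe, hval]
  exact hcd

end AdCurve

/-! ### 4. Central words commute with `r(exp Y)` -/

section Central

variable {A : Type*} [NormedCommRing A] [NormedAlgebra ℝ A] [NormedAlgebra ℚ A] [CompleteSpace A]
  [StarRing A] {N : Type*} [Fintype N] [DecidableEq N] {H : RealMatrixGroup A N}
  {G : Type*} [Group G] (ι : H.carrier →* G)

/-- Substituting `Ad 1` for the letters does nothing. [folklore] -/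
theorem lift_Ad_one (p : FreeAlgebra ℝ H.lie) :
    FreeAlgebra.lift ℝ (FreeAlgebra.ι ℝ ∘ H.Ad 1) p = p := by
  have hfun : (FreeAlgebra.ι ℝ ∘ H.Ad 1 : H.lie → FreeAlgebra ℝ H.lie) =
      (AlgHom.id ℝ (FreeAlgebra ℝ H.lie) : FreeAlgebra ℝ H.lie → FreeAlgebra ℝ H.lie) ∘
        FreeAlgebra.ι ℝ := by
    funext X
    simp only [Function.comp_apply, AlgHom.coe_id, id_eq]
    congr 1
    ext1
    simp
  rw [hfun, FreeAlgebra.lift_comp_ι]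
  rfl

variable [FiniteDimensional ℝ A]

-- the scoped `L∞`-operator normed structure on matrices (only reducibly defeq to the Pi one)
set_option backward.isDefEq.respectTransparency false in
open scoped Matrix.Norms.Operator in
/-- **`Ad(exp Y)` acts trivially on central words, through smooth functions**: for `p ∈ ℝ⟨𝔤⟩`
central, `φ` smooth and `Y ∈ 𝔤 = 𝔤𝔩(N, A)`, `(Ad(exp Y) · p) φ = p φ`. Proof in the module
docstring (`u(t) = ((Ad(exp tY) · p) φ)(g)` has derivative `([Y, Ad(exp tY) p] φ)(g) = 0`).
Borel–Jacquet 1979, §1.6 and 4.3 (ii); Borel 1997, 2.2 and 2.16. [cite: BorelJacquet1979, §1.6] -/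
theorem applyFree_lift_Ad_expMem_of_isCentralWord (hH : H.lie = ⊤) (hc : H.carrier = ⊤)
    (Y : H.lie) {p : FreeAlgebra ℝ H.lie} (hp : IsCentralWord p) {φ : G → ℂ}
    (hφ : IsArchSmooth ι φ) :
    applyFree ι (FreeAlgebra.lift ℝ (FreeAlgebra.ι ℝ ∘ H.Ad (H.expMem Y)) p) φ = applyFree ι p φ := by
  classical
  set b := FreeAlgebra.basisFreeMonoid ℝ H.lie with hb
  set ψ : archSmooth ι := ⟨φ, (mem_archSmooth_iff ι φ).2 hφ⟩ with hψ
  -- the exponential curve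
  set e : ℝ → H.carrier := fun t => H.expMem (t • Y) with he
  funext g
  -- the function `u`
  set u : ℝ → ℂ := fun t =>
    applyFree ι (FreeAlgebra.lift ℝ (FreeAlgebra.ι ℝ ∘ H.Ad (e t)) p) φ g with hu
  -- letters of a word moved by `Ad(exp tY)`, and their matrices
  let Zt : ∀ w : FreeMonoid H.lie, ℝ → Fin (FreeMonoid.toList w).length → H.lie :=
    fun w t i => H.Ad (e t) ((FreeMonoid.toList w)[(i : ℕ)])
  let tup : ∀ w : FreeMonoid H.lie, ℝ → Fin (FreeMonoid.toList w).length → Matrix N N A :=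
    fun w t i => ((Zt w t i : H.lie) : Matrix N N A)
  let dtup : ∀ w : FreeMonoid H.lie, ℝ → Fin (FreeMonoid.toList w).length → Matrix N N A :=
    fun w t i => ((⁅Y, Zt w t i⁆ : H.lie) : Matrix N N A)
  have htup : ∀ w t, HasDerivAt (tup w) (dtup w t) t := fun w t =>
    hasDerivAt_pi.2 fun i => RealMatrixGroup.hasDerivAt_coe_Ad_expMem Y _ t
  -- the continuous multilinear maps `Λ_w`
  let Λ : ∀ w : FreeMonoid H.lie,
      ContinuousMultilinearMap ℝ (fun _ : Fin (FreeMonoid.toList w).length => Matrix N N A) ℂ :=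
    fun w => iterLieDerivCML hH hc ψ g (FreeMonoid.toList w).length
  have hΛtup : ∀ w t, Λ w (tup w t) = iterLieDeriv ι ((FreeMonoid.toList w).map (H.Ad (e t))) φ g := by
    intro w t
    change iterLieDerivCML hH hc ψ g (FreeMonoid.toList w).length (tup w t) = _
    rw [iterLieDerivCML_apply]
    simp only [tup, Zt, RealMatrixGroup.lieOfTop_coe, List.ofFn_getElem_eq_map]
    rfl
  -- expansion of `u` over the word basis
  have hu_exp : ∀ t, u t = (b.repr p).sum fun w c => (c : ℂ) * Λ w (tup w t) := by
    intro t
    simp only [hu, applyFree_lift_comp, Finsupp.sum, Finset.sum_apply, Pi.smul_apply, smul_eq_mul,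
      hΛtup]
    rfl
  -- derivative of each summand
  have hderiv_w : ∀ w t, HasDerivAt (fun s => Λ w (tup w s))
      (∑ i, Λ w (Function.update (tup w t) i (dtup w t i))) t := by
    intro w t
    have h := ((Λ w).hasFDerivAt (tup w t)).comp_hasDerivAt t (htup w t)
    rwa [ContinuousMultilinearMap.linearDeriv_apply] at h
  -- the summands of the derivative are word actions
  have hsum_w : ∀ w t, ∑ i, Λ w (Function.update (tup w t) i (dtup w t i)) =
      applyFree ι (∑ i, wordFn H (Function.update (Zt w t) i ⁅Y, Zt w t i⁆)) φ g := by
    intro w t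
    rw [applyFree_finset_sum, Finset.sum_apply]
    refine Finset.sum_congr rfl fun i _ => ?_
    rw [applyFree_wordFn]
    change iterLieDerivCML hH hc ψ g (FreeMonoid.toList w).length _ = _
    rw [iterLieDerivCML_apply]
    congr 2
    funext j
    by_cases hj : j = i
    · subst hj
      simp only [Function.update_self, dtup, RealMatrixGroup.lieOfTop_coe]
    · simp only [Function.update_of_ne hj, tup, RealMatrixGroup.lieOfTop_coe]
  -- the derivative of `u` is the action of the word `q t`
  set q : ℝ → FreeAlgebra ℝ H.lie := fun t =>
    (b.repr p).sum fun w c => c • ∑ i, wordFn H (Function.update (Zt w t) i ⁅Y, Zt w t i⁆) with hq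
  have hu_deriv : ∀ t, HasDerivAt u (applyFree ι (q t) φ g) t := by
    intro t
    have hfun : u = fun s => (b.repr p).sum fun w c => (c : ℂ) * Λ w (tup w s) := funext hu_exp
    rw [hfun]
    have h : HasDerivAt (fun s => (b.repr p).sum fun w c => (c : ℂ) * Λ w (tup w s))
        (∑ w ∈ (b.repr p).support,
          (b.repr p w : ℂ) * ∑ i, Λ w (Function.update (tup w t) i (dtup w t i))) t := by
      simp only [Finsupp.sum]
      exact HasDerivAt.fun_sum fun w _ => (hderiv_w w t).const_mul _
    convert h using 1
    rw [hq]
    simp only [Finsupp.sum]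
    rw [applyFree_finset_sum, Finset.sum_apply]
    refine Finset.sum_congr rfl fun w _ => ?_
    rw [applyFree_smul_left, Pi.smul_apply, smul_eq_mul, hsum_w]
  -- `q t` maps to `[ι Y, Ad(exp tY) p] = 0` in `U(𝔤)`
  have hq_env : ∀ t, freeToEnveloping H (q t) = 0 := by
    intro t
    have hcent := isCentralWord_lift_Ad (H := H) (e t) hp
    unfold IsCentralWord at hcent
    rw [Subalgebra.mem_center_iff] at hcent
    -- `Ad(e t) · p` in the word basis
    have hword : ∀ w : FreeMonoid H.lie,
        FreeAlgebra.lift ℝ (FreeAlgebra.ι ℝ ∘ H.Ad (e t)) (b w) = wordFn H (Zt w t) := by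
      intro w
      rw [hb, lift_ι_comp_basisFreeMonoid, wordFn]
      congr 1
      apply FreeMonoid.toList.injective
      rw [FreeMonoid.toList_ofList, FreeMonoid.toList_map]
      exact (List.ofFn_getElem_eq_map (FreeMonoid.toList w) (H.Ad (e t))).symm
    have hAdp : FreeAlgebra.lift ℝ (FreeAlgebra.ι ℝ ∘ H.Ad (e t)) p =
        ∑ w ∈ (b.repr p).support, b.repr p w • wordFn H (Zt w t) := by
      conv_lhs => rw [← b.linearCombination_repr p, Finsupp.linearCombination_apply, map_finsuppSum]
      simp only [Finsupp.sum, map_smul, hword]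
    have hcomm := hcent (UniversalEnvelopingAlgebra.ι ℝ Y)
    rw [hAdp, map_sum, Finset.mul_sum, Finset.sum_mul] at hcomm
    rw [hq]
    simp only [Finsupp.sum]
    rw [map_sum]
    simp_rw [map_smul, freeToEnveloping_sum_wordFn_update_bracket, smul_sub, Finset.sum_sub_distrib]
    simp only [map_smul, mul_smul_comm, smul_mul_assoc] at hcomm
    rw [hcomm, sub_self]
  have hu_deriv0 : ∀ t, HasDerivAt u 0 t := by
    intro t
    have h := hu_deriv t
    have hzero : applyFree ι (q t) φ = applyFree ι 0 φ :=
      applyFree_congr_of_top ι hH hc (by rw [hq_env t, map_zero]) hφ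
    rwa [hzero, applyFree_zero_left, Pi.zero_apply] at h
  -- `u` is constant
  have hconst : u 1 = u 0 :=
    is_const_of_deriv_eq_zero (fun t => (hu_deriv0 t).differentiableAt)
      (fun t => (hu_deriv0 t).deriv) 1 0
  have h1 : e 1 = H.expMem Y := by simp [he]
  have h0 : e 0 = 1 := by
    simp only [he, zero_smul]
    exact RealMatrixGroup.expMem_zero
  simp only [hu, h1, h0, lift_Ad_one] at hconst
  exact hconst

/-- **Central words commute with right translation by exponentials**: for `p ∈ ℝ⟨𝔤⟩` central,
`φ` smooth and `Y ∈ 𝔤 = 𝔤𝔩(N, A)`, `p (r(exp Y) φ) = r(exp Y) (p φ)`.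
Borel–Jacquet 1979, §1.6 and 4.3 (ii); Borel 1997, 2.2 (`Z(𝔤)` = bi-invariant operators).
[cite: BorelJacquet1979, §1.6] -/
theorem applyFree_archTranslate_expMem_of_isCentralWord (hH : H.lie = ⊤) (hc : H.carrier = ⊤)
    (Y : H.lie) {p : FreeAlgebra ℝ H.lie} (hp : IsCentralWord p) {φ : G → ℂ}
    (hφ : IsArchSmooth ι φ) :
    applyFree ι p (archTranslate ι (H.expMem Y) φ) = archTranslate ι (H.expMem Y) (applyFree ι p φ) := by
  rw [applyFree_archTranslate, ← RealMatrixGroup.expMem_neg,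
    applyFree_lift_Ad_expMem_of_isCentralWord ι hH hc (-Y) hp hφ]

end Central

/-! ### 5. The `GL_n` datum -/

section GLDatum

open NumberField NumberField.mixedEmbedding
open scoped Classical

variable {n : ℕ} {K : Type} [Field K] [NumberField K]

/-- **`Z(𝔤)` commutes with right translation by exponentials on `GL_n(𝔸_K)`**: for the datum
`AutomorphyDatum.gl n K hcpt`, `p` a central word, `φ` smooth in the archimedean variable and
`x = exp Y ∈ GL_n(K_∞)`, `p (r(x) φ) = r(x) (p φ)` (`r(x)` = right translation by
`GLn.ofInfinite x`). Borel–Jacquet 1979, §1.6 and 4.3 (ii). [cite: BorelJacquet1979, 4.3 (ii)] -/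
theorem applyFree_rightTranslation_of_mem_range_expGL (hcpt : isCompact_glFiniteIntegralLevel n K)
    {p : FreeAlgebra ℝ (archGroupGL n K).lie} (hp : IsCentralWord p)
    {φ : (AdelicGroupData.gl n K).Adelic → ℂ} (hφ : IsArchSmooth (AutomorphyDatum.gl n K hcpt).ofArch φ)
    {x : GL (Fin n) (mixedSpace K)}
    (hx : x ∈ Set.range (expGL : Matrix (Fin n) (Fin n) (mixedSpace K) → GL (Fin n) (mixedSpace K))) :
    applyFree (AutomorphyDatum.gl n K hcpt).ofArch p
        (rightTranslation (AdelicGroupData.gl n K) (GLn.ofInfinite n K x) φ) =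
      rightTranslation (AdelicGroupData.gl n K) (GLn.ofInfinite n K x)
        (applyFree (AutomorphyDatum.gl n K hcpt).ofArch p φ) := by
  obtain ⟨M, rfl⟩ := hx
  set Y : (archGroupGL n K).lie := RealMatrixGroup.lieOfTop (archGroupGL_lie n K) M with hY
  have hexp : ((archGroupGL n K).expMem Y : GL (Fin n) (mixedSpace K)) = expGL M := rfl
  have hr : rightTranslation (AdelicGroupData.gl n K) (GLn.ofInfinite n K (expGL M)) =
      archTranslate (AutomorphyDatum.gl n K hcpt).ofArch ((archGroupGL n K).expMem Y) := by
    rw [AutomorphyDatum.archTranslate_ofArch, AutomorphyDatum.gl_ofArch_apply, hexp]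
  rw [hr]
  exact applyFree_archTranslate_expMem_of_isCentralWord _ (archGroupGL_lie n K)
    (archGroupGL_carrier n K) Y hp hφ

end GLDatum

end Literature.NumberTheory.Automorphic
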